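import Summits.ABC.IUTFork.Conditional.AbcOfSGenuineKChosenDepthHexSharpEngine
import HarnessLib

/-!
# Branch C / R-W «GENUINE-NEG» (D-0079 rescue sub-cell R-W, director-abc W13 (B), rw-num-lead F1-3/F1-4): the HEX datum
# `λ_k = 1/2 + 2/7^k` is DECIDED on the refuted side from `k = 13` on at every prime `11 ≤ l ≤ 1680`, MODULO THE LOCAL TYPE
# «`e(K_{x₀}/ℚ_7) ∣ 60·l` at every place `x₀ | 7` of `T.K`» (taken as an explicit hypothesis; engine = p457581 §3 with `46080·l ↦ E`)

PROOF-ONLY file (0 definitions, 0 `Prop` facts, no instance, no notation) of the abc-iut cell (seat abc-iut-W-neg-2, gen 0; R-W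
GENUINE-NEG seat 2 of 2, share (2) «explicit-depth INSTANTIATION at the genuine datum `k = 15` (then 13, 14, 16) with the local
type as a hypothesis until the LOCAL-TYPE LEMMA of seat 1 / LT-a / LT-c lands»). TAKES NO SIDE on [IUTchIII] Cor. 3.12
(S. Mochizuki, *Inter-universal Teichmüller theory III*, RIMS manuscript, Cor. 3.12 p. 173–174, Step (xi-f) p. 184) or on any author.

WHAT IS ADDED (composition BY NAME; no new engine, nothing restated). abc-iut-w5-d163's HEX-SHARP engine
`GenuineK.exists_deep_place_lamSeven_of_le` (`AbcOfSGenuineKChosenDepthHexSharpEngine`, p457581) runs on the UNCONDITIONAL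
ramification bound `e(K_x/ℚ_7) ≤ 46080·l` (its §1), whence `b ≤ n − 1/e` only for `46080·l < 6·7ⁿ` (`n = 6` at `l = 11`) and the
HEX frontier `k ≥ 20–21`. rw-num-lead's finding F1-4 (HOME/plan/rescue/R-W/README.md) names the decisive missing input: the
LOCAL TYPE at `7` — «`∀ x₀ | 7 of T.K: 7 ∤ e(K_{x₀}/ℚ_7) ∧ e(K_{x₀}/ℚ_7) ∣ 60·l`» (Kummer theory of the Tate curve `E_q[30l]` over
`F‡ = ℚ(√−1, √λ, √(λ−1), E_λ[15])`; seat abc-iut-W-neg-1 / pieces LT-a, LT-c of C-R40 add. 2) — under which `e < 2058 = 6·7³` for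
`l ≤ 34`, so `b ≤ 3 − 1/e`, `d + a + b < 21/5`, and the same floor-free criterion `l·((l+1)(10n+12)+20) ≤ 5k(l−3)(l+1)` reaches
`k ≥ 13` at `l = 11` (`k ≥ 12` at `13 ≤ l ≤ 31`, `k ≥ 11` at `17 ≤ l ≤ 31`, `k ≥ 10` at `l ∈ {23, 29, 31}`).

* §1 `GenuineK.exists_deep_place_lamSeven_of_ramification_le` — p457581 §3 with its §1 bound replaced by a HYPOTHESIS
  `∀ x₀ | 7, e(K_{x₀}/ℚ_7) ≤ E`, `E < 6·7ⁿ` (any `E`: `E = 60·l` is F1-4's local type, `E = 30·l` the sharper LT-c reading,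
  `E = 46080·l` recovers p457581): at EVERY genuine Θ-volume datum `T` over `(ratPoint λ_k, l)` the top label `i = (l−1)/2 − 1` and
  a place `x₀ | 7` in the bad set satisfy abc-iut-w5-d107's explicit depth inequality
  `7^{((i+2)(d+a+b)+1)}·‖t_q(x₀)‖^{(i+1)²−1} < 1` at the CHOSEN realising q-idele (`‖t_q(x₀)‖ = 7^{−k/l}`, abc-iut-c312-7
  `GenuineK.exists_place_lamSeven`; constants by abc-iut-w5-d163 `HexSharp.depthConstants_le`).
* §2 `GenuineK.not_pilotKummerCompatHull_lamSeven_of_ramification_le` — the same hypotheses ⟹ per datum, for EVERY choice of the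
  free context binders and Kummer data, the hull-level clause `Cor312Vol.PilotKummerCompatHull` at the sharp genuine K-setting with
  the CHOSEN realising ideles and the PINNED reading FAILS (abc-iut-C-cert-1 `GenuineK.not_pilotKummerCompatHull_chosen_of_explicit_depth`,
  p438886) — the per-datum instance shape of the binder `hSHw` of the window certificate `Conditional.abc_of_SH_v10K_window` (p447945).
* §3 THE GENUINE-NEG TABLE under F1-4's local type VERBATIM (`hloc : ∀ x₀ | 7, ¬ 7 ∣ e ∧ e ∣ 60·l`):
  `HexLocalType.exists_deep_place_lamSeven_of_dvd` / `HexLocalType.not_pilotKummerCompatHull_lamSeven_of_dvd` — EVERY `k ≥ 13` and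
  EVERY prime `11 ≤ l ≤ 1680` (`n = 3` for `l ≤ 34`, `n = 4` for `l ≤ 240`, `n = 5` for `l ≤ 1680`; criterion checked at `k = 13`,
  monotone in `k`): the director's genuine datum `k = 15` (both genuine local types `e(v|7) ∈ {1, 2}` of WINDOW-TABLE rows `k15-*`
  divide `60`) and `k = 13, 14, 16` at every tabulated `l` are the instances `(k := 15)` etc.; `exists_window_frontier` records the
  engine's reach below 13 (`k = 12` at `13 ≤ l ≤ 240`, `k = 11` at `17…34 ∪ 67…240`, `k = 10` at `23, 29, 31`). When the LOCAL-TYPE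
  LEMMA lands as `∀ T x₀, ¬ 7 ∣ e ∧ e ∣ 60·l`, `hloc` is discharged by one application (rows decided unconditionally).

HONEST SCOPE: SHARP reading (Θ-possible-image set constant in `m`, typed (Ind1)/(Ind2)); the per-label licence is a
STRONGER-THAN-PRINT sufficient form of (xi-f) (ADJUDICATION-SPEC (G1′)); a deep top-label packet says NOTHING about the printed GLOBAL
inequality `−|log(q)| ≤ −|log(Θ)|`, the number-level `Cor22.Cor312AtDatum`, or any author's intended hull; every HEX row is
Szpiro-GOOD (abc-iut-c312-d1), so these rows consume no hypothesis of the cut certificates `…_szpiroBad…` — they test the WINDOW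
binder `hSHw` of the uncut records only; CONDITIONAL on the local type `hloc` until that lemma lands; no side taken on any author;
typed ≠ proved; refuted-as-typed ≠ refuted-in-print; no abc claim.
[cite: Mochizuki2012, IUTchIII Cor. 3.12 Step (xi-f) p. 184; IUTchIV Prop. 1.2 p. 10, Prop. 1.8 (vii) p. 19, Cor. 2.2 (ii) proof (P5) p. 46]
[cite: SerreLocalFields1979, Ch. III §6 Prop. 13] [cite: DupuyHilado2025, §3.4] [claim: Mochizuki2012, status: disputed] for every IUT quotation.
-/

noncomputable section

open Set Function NumberField IsDedekindDomain

namespace Summit.ABC.IUTFork.Conditional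

open Thm311 Thm311.Real Cor312 Cor312Vol Cor312Prov Literature.IUT.LogThetaLattice Literature.IUT.LogVolume
  Literature.IUT.HodgeTheaters Literature.IUT.LogVolume.ThetaData
  Literature.NumberTheory.NumberFields Literature.NumberTheory.DiophantineGeometry.GenEll
  Literature.NumberTheory.DiophantineGeometry Summit.ABC.ABC.Theorems

/-! ## §1. The engine of p457581 §3 with the ramification bound as a hypothesis -/

/-- **HEX depth under a LOCAL ramification bound (engine form).** Let `l ≥ 11` be prime, `k ≥ 1`, `E < 6·7ⁿ` and
`l·((l+1)(10n+12) + 20) ≤ 5·k·((l−3)(l+1))` (⟺ `(j+1)(n + 6/5) + 1 ≤ (k/l)(j²−1)`, `j = (l−1)/2`). Then at EVERY genuine Θ-volume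
datum `T` over `(ratPoint λ_k, l)`, `λ_k = 1/2 + 2/7^k`, whose places `x₀ | 7` all have `e(K_{x₀}/ℚ_7) ≤ E`, the top label
`i = j − 1` and some place `x₀ | 7` in the bad set of `pilotDataOfK T.D T.K` satisfy the explicit depth inequality
`7^{((i+2)(d+a+b)+1)}·‖t_q(x₀)‖^{(i+1)²−1} < 1` at the CHOSEN realising q-idele (hypothesis `hdeep` of
`GenuineK.not_pilotKummerCompatHull_chosen_of_explicit_depth`). Proof = p457581 §3 verbatim with its §1 bound replaced by `hloc`.
[cite: Mochizuki2012, IUTchIII Cor. 3.12 Step (xi-f) p. 184; IUTchIV Prop. 1.2 p. 10, Cor. 2.2 (ii) proof (P5) p. 46] [claim: Mochizuki2012, status: disputed] -/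
theorem GenuineK.exists_deep_place_lamSeven_of_ramification_le {k l n E : ℕ} (hk : 1 ≤ k) (hl : l.Prime) (h11 : 11 ≤ l)
    (hE : E < 6 * 7 ^ n) (hkl : l * ((l + 1) * (10 * n + 12) + 20) ≤ 5 * k * ((l - 3) * (l + 1)))
    (T : Cor22.ThetaVolumeDatumAt (ratPoint ((2 : ℚ)⁻¹ + 2 / 7 ^ k)) l)
    (hloc : letI := T.instFieldF; letI := T.instNumberFieldF; letI := T.instAlgebraF; letI := T.instFieldK
      letI := T.instNumberFieldK; letI := T.instAlgebraK; letI := T.instFieldFbar; letI := T.instAlgebraFbar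
      letI := T.instAlgebraKFbar; letI := T.instIsElliptic
      haveI : Fact (Nat.Prime 7) := ⟨by norm_num⟩
      ∀ x₀ : (thetaIndex (pilotDataOfK T.D T.K)).Fibre (.inr ⟨7, by norm_num⟩),
        absRamificationIdx 7 (kOf (pilotDataOfK T.D T.K) 7 x₀) ≤ E) :
    letI := T.instFieldF; letI := T.instNumberFieldF; letI := T.instAlgebraF; letI := T.instFieldK
    letI := T.instNumberFieldK; letI := T.instAlgebraK; letI := T.instFieldFbar; letI := T.instAlgebraFbar
    letI := T.instAlgebraKFbar; letI := T.instIsElliptic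
    haveI : Fact (Nat.Prime 7) := ⟨by norm_num⟩
    ∃ (i : Fin (thetaIndex (pilotDataOfK T.D T.K)).lstar) (x₀ : (thetaIndex (pilotDataOfK T.D T.K)).Fibre (.inr ⟨7, by norm_num⟩)),
      (i : ℕ) = (l - 1) / 2 - 1 ∧
      placeOf (pilotDataOfK T.D T.K) 7 x₀ ∈ (pilotDataOfK T.D T.K).S ∧
      (7 : ℝ) ^ ((((i : ℕ) : ℝ) + 2) * (differentOrd 7 (kOf (pilotDataOfK T.D T.K) 7 x₀)
          + logRadiusA 7 (absRamificationIdx 7 (kOf (pilotDataOfK T.D T.K) 7 x₀))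
          + logRadiusB 7 (absRamificationIdx 7 (kOf (pilotDataOfK T.D T.K) 7 x₀))) + 1) *
        ‖(exists_realising_qIdeles_pilotDataOfK T.D).choose ⟨7, by norm_num⟩ x₀‖ ^ (((i : ℕ) + 1) ^ 2 - 1) < 1 := by
  classical
  letI := T.instFieldF; letI := T.instNumberFieldF; letI := T.instAlgebraF; letI := T.instFieldK
  letI := T.instNumberFieldK; letI := T.instAlgebraK; letI := T.instFieldFbar; letI := T.instAlgebraFbar
  letI := T.instAlgebraKFbar; letI := T.instIsElliptic
  haveI : Fact (Nat.Prime 7) := ⟨by norm_num⟩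
  obtain ⟨x₀, hS, htame, -, -, hnorm⟩ := GenuineK.exists_place_lamSeven hk hl h11 T
  -- the top label
  have hlstar : (thetaIndex (pilotDataOfK T.D T.K)).lstar = (l - 1) / 2 := rfl
  have hil : (l - 1) / 2 - 1 < (thetaIndex (pilotDataOfK T.D T.K)).lstar := by rw [hlstar]; omega
  refine ⟨⟨(l - 1) / 2 - 1, hil⟩, x₀, rfl, hS, ?_⟩
  -- the LOCAL ramification bound (hypothesis) and the constants
  have he : absRamificationIdx 7 (kOf (pilotDataOfK T.D T.K) 7 x₀) ≤ E := hloc x₀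
  have hepos : 0 < absRamificationIdx 7 (kOf (pilotDataOfK T.D T.K) 7 x₀) := absRamificationIdx_pos _ _
  have he' : (0 : ℝ) < absRamificationIdx 7 (kOf (pilotDataOfK T.D T.K) 7 x₀) := by exact_mod_cast hepos
  set B : ℝ := n + 6 / 5 - 1 / (absRamificationIdx 7 (kOf (pilotDataOfK T.D T.K) 7 x₀) : ℝ) with hBdef
  have hX := HexSharp.depthConstants_le (kOf (pilotDataOfK T.D T.K) 7 x₀) n htame (lt_of_le_of_lt he hE)
  -- label arithmetic: `j = (l−1)/2`, `2(j+1) = l+1`, `4(j²−1) = (l−3)(l+1)`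
  set j : ℕ := (l - 1) / 2 with hj
  have h2j : 2 * j = l - 1 := by
    have hodd : l % 2 = 1 := Nat.odd_iff.mp (hl.odd_of_ne_two (by omega))
    omega
  have hj5 : 5 ≤ j := by omega
  have hjR : (j : ℝ) = ((l : ℝ) - 1) / 2 := by
    have : ((2 * j : ℕ) : ℝ) = ((l - 1 : ℕ) : ℝ) := by exact_mod_cast h2j
    push_cast [Nat.cast_sub (show 1 ≤ l by omega)] at this
    linarith
  have hcast1 : ((((l - 1) / 2 - 1 : ℕ) : ℝ) + 2) = (j : ℝ) + 1 := by
    rw [← hj, Nat.cast_sub (show 1 ≤ j by omega)]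
    push_cast; ring
  have hidx : (l - 1) / 2 - 1 + 1 = j := by rw [← hj]; omega
  have hcast2 : (((j ^ 2 - 1 : ℕ)) : ℝ) = ((j : ℝ) - 1) * ((j : ℝ) + 1) := by
    have : 1 ≤ j ^ 2 := Nat.one_le_pow _ _ (by omega)
    push_cast [Nat.cast_sub this]
    ring
  -- the hypothesis `hkl` in real form: `(j+1)(n + 6/5) + 1 ≤ (k/l)·(j−1)(j+1)`
  have hl0 : (0 : ℝ) < l := by exact_mod_cast hl.pos
  have hklR : ((j : ℝ) + 1) * ((n : ℝ) + 6 / 5) + 1 ≤ (k : ℝ) / l * (((j : ℝ) - 1) * ((j : ℝ) + 1)) := by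
    have h := hkl
    have h3 : 3 ≤ l := by omega
    have hR : ((l * ((l + 1) * (10 * n + 12) + 20) : ℕ) : ℝ) ≤ ((5 * k * ((l - 3) * (l + 1)) : ℕ) : ℝ) := by
      exact_mod_cast h
    push_cast [Nat.cast_sub h3] at hR
    rw [hjR]
    rw [div_mul_eq_mul_div, le_div_iff₀ hl0]
    nlinarith
  -- strictness from the `−1/e` in `B`
  have hlt : (((((l - 1) / 2 - 1 : ℕ)) : ℝ) + 2) * B + 1 <
      (k : ℝ) / l * ((((((l - 1) / 2 - 1 : ℕ)) + 1) ^ 2 - 1 : ℕ) : ℝ) := by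
    rw [hcast1, hidx, hcast2, hBdef]
    have hpos : 0 < ((j : ℝ) + 1) * (1 / (absRamificationIdx 7 (kOf (pilotDataOfK T.D T.K) 7 x₀) : ℝ)) := by
      have : (0 : ℝ) < (j : ℝ) + 1 := by positivity
      positivity
    nlinarith
  have h := rpow_mul_pow_lt_one_of_lt (p := (7 : ℝ)) (by norm_num) (i := (l - 1) / 2 - 1) hX hlt
  rw [hnorm]
  exact h

/-! ## §2. Per datum: the hull-level clause S_H fails (every choice of the free binders) -/

/-- **S_H FAILS at every datum over `(λ_k, l)` satisfying the local ramification bound.** Under the hypotheses of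
`GenuineK.exists_deep_place_lamSeven_of_ramification_le` (`l ≥ 11` prime, `k ≥ 1`, `E < 6·7ⁿ`, the criterion, and
`e(K_{x₀}/ℚ_7) ≤ E` at every `x₀ | 7`), at the genuine Θ-volume datum `T` over `(ratPoint λ_k, l)`, for EVERY region field,
columns, frames, lattice, Frobenioid signature, q-pilot data and Kummer datum `qK`: the hull-level clause
`Cor312Vol.PilotKummerCompatHull` at the sharp genuine setting over `K` with the CHOSEN realising ideles and the PINNED reading (the
per-datum instance shape of the `hSH`/`hSHw` binders of the branch-C certificates) is FALSE — abc-iut-C-cert-1's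
`GenuineK.not_pilotKummerCompatHull_chosen_of_explicit_depth` at the deep packet of §1. Sharp reading; refuted-as-typed only; nothing
about the number-level Corollary. [cite: Mochizuki2012, IUTchIII Cor. 3.12 Step (xi-f) p. 184] [claim: Mochizuki2012, status: disputed] -/
theorem GenuineK.not_pilotKummerCompatHull_lamSeven_of_ramification_le {k l n E : ℕ} (hk : 1 ≤ k) (hl : l.Prime)
    (h11 : 11 ≤ l) (hE : E < 6 * 7 ^ n) (hkl : l * ((l + 1) * (10 * n + 12) + 20) ≤ 5 * k * ((l - 3) * (l + 1)))
    (T : Cor22.ThetaVolumeDatumAt (ratPoint ((2 : ℚ)⁻¹ + 2 / 7 ^ k)) l)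
    (hloc : letI := T.instFieldF; letI := T.instNumberFieldF; letI := T.instAlgebraF; letI := T.instFieldK
      letI := T.instNumberFieldK; letI := T.instAlgebraK; letI := T.instFieldFbar; letI := T.instAlgebraFbar
      letI := T.instAlgebraKFbar; letI := T.instIsElliptic
      haveI : Fact (Nat.Prime 7) := ⟨by norm_num⟩
      ∀ x₀ : (thetaIndex (pilotDataOfK T.D T.K)).Fibre (.inr ⟨7, by norm_num⟩),
        absRamificationIdx 7 (kOf (pilotDataOfK T.D T.K) 7 x₀) ≤ E) :
    letI := T.instFieldF; letI := T.instNumberFieldF; letI := T.instAlgebraF; letI := T.instFieldK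
    letI := T.instNumberFieldK; letI := T.instAlgebraK; letI := T.instFieldFbar; letI := T.instAlgebraFbar
    letI := T.instAlgebraKFbar; letI := T.instIsElliptic
    ∀ (M : Type) [Field M] [NumberField M]
      (archPk : ∀ (j : (thetaIndex (pilotDataOfK T.D T.K)).Label) (vQ : (thetaIndex (pilotDataOfK T.D T.K)).VQ),
        Set ((logShellsDH (pilotDataOfK T.D T.K) (analyticLogv T.K)).Packet j vQ))
      (archSub : ∀ (j : (thetaIndex (pilotDataOfK T.D T.K)).Label) (v : (thetaIndex (pilotDataOfK T.D T.K)).V),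
        Set ((logShellsDH (pilotDataOfK T.D T.K) (analyticLogv T.K)).Packet j ((thetaIndex (pilotDataOfK T.D T.K)).over v)))
      (Ψ : ℤ → ∀ v : (thetaIndex (pilotDataOfK T.D T.K)).V, v ∈ (thetaIndex (pilotDataOfK T.D T.K)).Vbad →
        Set ((logShellsDH (pilotDataOfK T.D T.K) (analyticLogv T.K)).StarPacket v))
      (act : ℤ → ∀ v : (thetaIndex (pilotDataOfK T.D T.K)).V, v ∈ (thetaIndex (pilotDataOfK T.D T.K)).Vbad →
        (logShellsDH (pilotDataOfK T.D T.K) (analyticLogv T.K)).StarPacket v →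
          Module.End ℚ ((logShellsDH (pilotDataOfK T.D T.K) (analyticLogv T.K)).StarPacket v))
      (Mmod : ℤ → ∀ j : (thetaIndex (pilotDataOfK T.D T.K)).LabelStar,
        Set ((logShellsDH (pilotDataOfK T.D T.K) (analyticLogv T.K)).GlobalPacket j.1))
      (region : ℤ → ∀ j : (thetaIndex (pilotDataOfK T.D T.K)).LabelStar, FinDivisor M →
        ∀ vQ : (thetaIndex (pilotDataOfK T.D T.K)).VQ, Set ((logShellsDH (pilotDataOfK T.D T.K) (analyticLogv T.K)).Packet j.1 vQ))
      (frobAdm : ℤ → ℤ → ∀ (j : (thetaIndex (pilotDataOfK T.D T.K)).Label) (vQ : (thetaIndex (pilotDataOfK T.D T.K)).VQ),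
        Set ((logShellsDH (pilotDataOfK T.D T.K) (analyticLogv T.K)).Packet j vQ) → Prop)
      (frobLogvol : ℤ → ℤ → ∀ (j : (thetaIndex (pilotDataOfK T.D T.K)).Label) (vQ : (thetaIndex (pilotDataOfK T.D T.K)).VQ),
        Set ((logShellsDH (pilotDataOfK T.D T.K) (analyticLogv T.K)).Packet j vQ) → ℝ)
      (frobΨ : ℤ → ℤ → ∀ v : (thetaIndex (pilotDataOfK T.D T.K)).V, v ∈ (thetaIndex (pilotDataOfK T.D T.K)).Vbad →
        Set ((logShellsDH (pilotDataOfK T.D T.K) (analyticLogv T.K)).StarPacket v))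
      (frobMmod : ℤ → ℤ → ∀ j : (thetaIndex (pilotDataOfK T.D T.K)).LabelStar,
        Set ((logShellsDH (pilotDataOfK T.D T.K) (analyticLogv T.K)).GlobalPacket j.1))
      (unitImage : ℤ → ℤ → ℕ → ∀ (j : (thetaIndex (pilotDataOfK T.D T.K)).Label) (vQ : (thetaIndex (pilotDataOfK T.D T.K)).VQ),
        Set ((logShellsDH (pilotDataOfK T.D T.K) (analyticLogv T.K)).Packet j vQ))
      (ballImage : ℤ → ℤ → ∀ (j : (thetaIndex (pilotDataOfK T.D T.K)).Label) (vQ : (thetaIndex (pilotDataOfK T.D T.K)).VQ),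
        Set ((logShellsDH (pilotDataOfK T.D T.K) (analyticLogv T.K)).Packet j vQ))
      (thetaDiv : ℤ → ℤ → LgpDivisor M (thetaIndex (pilotDataOfK T.D T.K)).lstar)
      (n : ℤ) {HT : Type} {LogLink : HT → HT → Type} {IsFull : ∀ {s t : HT}, LogLink s t → Prop}
      (lat : LGPGaussianLogThetaLattice LogLink IsFull)
      {Frd : Type} {IsoF : Frd → Frd → Type} {Ob : Frd → Type} {realify : Frd → Frd} {Strip : Type}
      {IsoS : Strip → Strip → Type} {Mv : ∀ v : (thetaIndex (pilotDataOfK T.D T.K)).V, v ∈ (thetaIndex (pilotDataOfK T.D T.K)).Vbad → Type}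
      [∀ v h, Monoid (Mv v h)]
      (sig : GlobalLGPFrobenioidSignature (thetaIndex (pilotDataOfK T.D T.K)).lstar (thetaIndex (pilotDataOfK T.D T.K)).V
        (· ∈ (thetaIndex (pilotDataOfK T.D T.K)).Vbad) Frd IsoF Ob realify Strip IsoS Mv)
      (split : SplittingMonoids Mv) {ObΔ : Type}
      {N : ∀ v : (thetaIndex (pilotDataOfK T.D T.K)).V, v ∈ (thetaIndex (pilotDataOfK T.D T.K)).Vbad → Type}
      [∀ v h, Monoid (N v h)] (qData : QPilotData ObΔ N)
      (qK : ∀ v : (thetaIndex (pilotDataOfK T.D T.K)).V, v ∈ (thetaIndex (pilotDataOfK T.D T.K)).Vbad →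
        Set ((logShellsDH (pilotDataOfK T.D T.K) (analyticLogv T.K)).StarPacket v)),
    ¬ Cor312Vol.PilotKummerCompatHull
        (LatticeSituation.ofShells (logShellsDH (pilotDataOfK T.D T.K) (analyticLogv T.K)) M archPk archSub
          (summandPiecesPr (pilotDataOfK T.D T.K) (logvAnalytic_analyticLogv (F := T.K))).Adm
          (summandPiecesPr (pilotDataOfK T.D T.K) (logvAnalytic_analyticLogv (F := T.K))).logvol Ψ act Mmod region frobAdm
          frobLogvol frobΨ frobMmod unitImage ballImage thetaDiv)
        (settingPrVolSharp (pilotDataOfK T.D T.K) (logvAnalytic_analyticLogv (F := T.K)) M archPk archSub Ψ act Mmod region n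
          lat sig split qData (exists_realising_qIdeles_pilotDataOfK T.D).choose (exists_realising_thetaIdeles_pilotDataOfK T.D).choose
          (exists_realising_qIdeles_pilotDataOfK T.D).choose_spec.1 (exists_realising_qIdeles_pilotDataOfK T.D).choose_spec.2.1)
        (fun _ => Cor312.Setting.qRegion
          (settingPrVolSharp (pilotDataOfK T.D T.K) (logvAnalytic_analyticLogv (F := T.K)) M archPk archSub Ψ act Mmod region n
            lat sig split qData (exists_realising_qIdeles_pilotDataOfK T.D).choose (exists_realising_thetaIdeles_pilotDataOfK T.D).choose
            (exists_realising_qIdeles_pilotDataOfK T.D).choose_spec.1 (exists_realising_qIdeles_pilotDataOfK T.D).choose_spec.2.1))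
        qK := by
  letI := T.instFieldF; letI := T.instNumberFieldF; letI := T.instAlgebraF; letI := T.instFieldK
  letI := T.instNumberFieldK; letI := T.instAlgebraK; letI := T.instFieldFbar; letI := T.instAlgebraFbar
  letI := T.instAlgebraKFbar; letI := T.instIsElliptic
  intro M _ _ archPk archSub Ψ act Mmod region frobAdm frobLogvol frobΨ frobMmod
    unitImage ballImage thetaDiv n' HT LogLink IsFull lat Frd IsoF Ob realify Strip IsoS Mv _ sig split ObΔ N _ qData qK
  obtain ⟨i, x₀, -, -, hdeep⟩ := GenuineK.exists_deep_place_lamSeven_of_ramification_le hk hl h11 hE hkl T hloc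
  exact GenuineK.not_pilotKummerCompatHull_chosen_of_explicit_depth T.D M archPk archSub Ψ act Mmod region frobAdm frobLogvol
    frobΨ frobMmod unitImage ballImage thetaDiv n' lat sig split qData qK ⟨7, by norm_num⟩ i x₀ hdeep

/-! ## §3. The GENUINE-NEG table under F1-4's local type «`7 ∤ e ∧ e ∣ 60·l` at every `x₀ | 7`» -/

namespace HexLocalType

/-- **The criterion at `E = 60·l`, every `k ≥ 13`, every prime `11 ≤ l ≤ 1680`**: there is an `n` with `60·l < 6·7ⁿ` and
`l·((l+1)(10n+12)+20) ≤ 5k(l−3)(l+1)` — namely `n = 3` for `l ≤ 34` (`23l² ≥ 192l + 195` at `k = 13`), `n = 4` for `35 ≤ l ≤ 240`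
(`13l² ≥ 202l + 195`), `n = 5` for `241 ≤ l ≤ 1680` (`3l² ≥ 212l + 195`); larger `k` by monotonicity. [folklore] -/
theorem exists_window_of_le_1680 {k l : ℕ} (hk : 13 ≤ k) (h11 : 11 ≤ l) (h1680 : l ≤ 1680) :
    ∃ n : ℕ, 60 * l < 6 * 7 ^ n ∧ l * ((l + 1) * (10 * n + 12) + 20) ≤ 5 * k * ((l - 3) * (l + 1)) := by
  have h3 : 3 ≤ l := by omega
  have hmono : ∀ n : ℕ, l * ((l + 1) * (10 * n + 12) + 20) ≤ 5 * 13 * ((l - 3) * (l + 1)) →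
      l * ((l + 1) * (10 * n + 12) + 20) ≤ 5 * k * ((l - 3) * (l + 1)) := fun n h =>
    h.trans (Nat.mul_le_mul_right _ (Nat.mul_le_mul_left _ hk))
  by_cases h34 : l ≤ 34
  · refine ⟨3, by omega, hmono 3 ?_⟩
    zify [h3]
    have h11' : (11 : ℤ) ≤ (l : ℤ) := by exact_mod_cast h11
    nlinarith [mul_nonneg (sub_nonneg.mpr h11') (by positivity : (0 : ℤ) ≤ 23 * (l : ℤ) + 61)]
  by_cases h240 : l ≤ 240
  · refine ⟨4, by omega, hmono 4 ?_⟩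
    zify [h3]
    have h35 : (35 : ℤ) ≤ (l : ℤ) := by exact_mod_cast (show 35 ≤ l by omega)
    nlinarith [mul_nonneg (sub_nonneg.mpr h35) (by positivity : (0 : ℤ) ≤ 13 * (l : ℤ) + 253)]
  · refine ⟨5, by omega, hmono 5 ?_⟩
    zify [h3]
    have h241 : (241 : ℤ) ≤ (l : ℤ) := by exact_mod_cast (show 241 ≤ l by omega)
    nlinarith [mul_nonneg (sub_nonneg.mpr h241) (by positivity : (0 : ℤ) ≤ 3 * (l : ℤ) + 511)]

/-- **The criterion at `E = 60·l` BELOW `k = 13` (the local-type frontier of this engine)**: `k = 12` at every `13 ≤ l ≤ 240`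
(`n = 3`: `18l² ≥ 182l + 180` for `13 ≤ l ≤ 34`; `n = 4`: `8l² ≥ 192l + 180` for `35 ≤ l ≤ 240`), `k = 11` at `17 ≤ l ≤ 34`
(`13l² ≥ 172l + 165`) and `67 ≤ l ≤ 240` (`3l² ≥ 182l + 165`), `k = 10` at `l ∈ {23, 29, 31}` (`8l² ≥ 162l + 150`).
(`(k, l) = (12, 11)` is the exact boundary `26.18… = 288/11` at `e = 660` and is NOT decided by `e ∣ 60·l` alone.) [folklore] -/
theorem exists_window_frontier {k l : ℕ}
    (h : (k = 12 ∧ 13 ≤ l ∧ l ≤ 240) ∨ (k = 11 ∧ (17 ≤ l ∧ l ≤ 34 ∨ 67 ≤ l ∧ l ≤ 240)) ∨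
      (k = 10 ∧ (l = 23 ∨ l = 29 ∨ l = 31))) :
    ∃ n : ℕ, 60 * l < 6 * 7 ^ n ∧ l * ((l + 1) * (10 * n + 12) + 20) ≤ 5 * k * ((l - 3) * (l + 1)) := by
  rcases h with ⟨rfl, h13, h240⟩ | ⟨rfl, hl⟩ | ⟨rfl, hl⟩
  · have h3 : 3 ≤ l := by omega
    by_cases h34 : l ≤ 34
    · refine ⟨3, by omega, ?_⟩
      zify [h3]
      have h13' : (13 : ℤ) ≤ (l : ℤ) := by exact_mod_cast h13
      nlinarith [mul_nonneg (sub_nonneg.mpr h13') (by positivity : (0 : ℤ) ≤ 18 * (l : ℤ) + 52)]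
    · refine ⟨4, by omega, ?_⟩
      zify [h3]
      have h35 : (35 : ℤ) ≤ (l : ℤ) := by exact_mod_cast (show 35 ≤ l by omega)
      nlinarith [mul_nonneg (sub_nonneg.mpr h35) (by positivity : (0 : ℤ) ≤ 8 * (l : ℤ) + 88)]
  · rcases hl with ⟨h17, h34⟩ | ⟨h67, h240⟩
    · refine ⟨3, by omega, ?_⟩
      have h3 : 3 ≤ l := by omega
      zify [h3]
      have h17' : (17 : ℤ) ≤ (l : ℤ) := by exact_mod_cast h17
      nlinarith [mul_nonneg (sub_nonneg.mpr h17') (by positivity : (0 : ℤ) ≤ 13 * (l : ℤ) + 49)]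
    · refine ⟨4, by omega, ?_⟩
      have h3 : 3 ≤ l := by omega
      zify [h3]
      have h67' : (67 : ℤ) ≤ (l : ℤ) := by exact_mod_cast h67
      nlinarith [mul_nonneg (sub_nonneg.mpr h67') (by positivity : (0 : ℤ) ≤ 3 * (l : ℤ) + 19)]
  · rcases hl with rfl | rfl | rfl <;> exact ⟨3, by norm_num, by norm_num⟩

/-- **GENUINE-NEG, depth form: every `k ≥ 13`, every prime `11 ≤ l ≤ 1680`, MODULO the local type.** At every genuine Θ-volume
datum `T` over `(ratPoint λ_k, l)` whose places `x₀ | 7` satisfy F1-4's local type «`7 ∤ e(K_{x₀}/ℚ_7) ∧ e(K_{x₀}/ℚ_7) ∣ 60·l`»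
(hypothesis `hloc`, the LOCAL-TYPE LEMMA's conclusion verbatim), the top label and some bad place `x₀ | 7` satisfy the explicit depth
inequality at the CHOSEN realising q-idele. [cite: Mochizuki2012, IUTchIII Cor. 3.12 Step (xi-f) p. 184; IUTchIV Prop. 1.2 p. 10]
[claim: Mochizuki2012, status: disputed] -/
theorem exists_deep_place_lamSeven_of_dvd {k l : ℕ} (hk : 13 ≤ k) (hl : l.Prime) (h11 : 11 ≤ l) (h1680 : l ≤ 1680)
    (T : Cor22.ThetaVolumeDatumAt (ratPoint ((2 : ℚ)⁻¹ + 2 / 7 ^ k)) l)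
    (hloc : letI := T.instFieldF; letI := T.instNumberFieldF; letI := T.instAlgebraF; letI := T.instFieldK
      letI := T.instNumberFieldK; letI := T.instAlgebraK; letI := T.instFieldFbar; letI := T.instAlgebraFbar
      letI := T.instAlgebraKFbar; letI := T.instIsElliptic
      haveI : Fact (Nat.Prime 7) := ⟨by norm_num⟩
      ∀ x₀ : (thetaIndex (pilotDataOfK T.D T.K)).Fibre (.inr ⟨7, by norm_num⟩),
        ¬ 7 ∣ absRamificationIdx 7 (kOf (pilotDataOfK T.D T.K) 7 x₀) ∧
          absRamificationIdx 7 (kOf (pilotDataOfK T.D T.K) 7 x₀) ∣ 60 * l) :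
    letI := T.instFieldF; letI := T.instNumberFieldF; letI := T.instAlgebraF; letI := T.instFieldK
    letI := T.instNumberFieldK; letI := T.instAlgebraK; letI := T.instFieldFbar; letI := T.instAlgebraFbar
    letI := T.instAlgebraKFbar; letI := T.instIsElliptic
    haveI : Fact (Nat.Prime 7) := ⟨by norm_num⟩
    ∃ (i : Fin (thetaIndex (pilotDataOfK T.D T.K)).lstar) (x₀ : (thetaIndex (pilotDataOfK T.D T.K)).Fibre (.inr ⟨7, by norm_num⟩)),
      (i : ℕ) = (l - 1) / 2 - 1 ∧
      placeOf (pilotDataOfK T.D T.K) 7 x₀ ∈ (pilotDataOfK T.D T.K).S ∧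
      (7 : ℝ) ^ ((((i : ℕ) : ℝ) + 2) * (differentOrd 7 (kOf (pilotDataOfK T.D T.K) 7 x₀)
          + logRadiusA 7 (absRamificationIdx 7 (kOf (pilotDataOfK T.D T.K) 7 x₀))
          + logRadiusB 7 (absRamificationIdx 7 (kOf (pilotDataOfK T.D T.K) 7 x₀))) + 1) *
        ‖(exists_realising_qIdeles_pilotDataOfK T.D).choose ⟨7, by norm_num⟩ x₀‖ ^ (((i : ℕ) + 1) ^ 2 - 1) < 1 := by
  obtain ⟨n, hn, hkl⟩ := exists_window_of_le_1680 hk h11 h1680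
  exact GenuineK.exists_deep_place_lamSeven_of_ramification_le (E := 60 * l) (by omega) hl h11 hn hkl T
    (fun x₀ => Nat.le_of_dvd (by omega) (hloc x₀).2)

/-- **GENUINE-NEG: the HEX datum `(λ_k, l)` is DECIDED on the refuted side for every `k ≥ 13` and every prime `11 ≤ l ≤ 1680`,
MODULO THE LOCAL TYPE.** At every genuine Θ-volume datum `T` over `(ratPoint λ_k, l)` whose places over `7` have F1-4's local type
(`hloc`), for EVERY choice of the free context binders and Kummer data, the hull-level clause S_H
(`Cor312Vol.PilotKummerCompatHull` at the sharp genuine K-setting, CHOSEN realising ideles, PINNED reading — the per-datum instance of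
`hSHw` of `abc_of_SH_v10K_window` p447945, whose degree-form window contains these data) FAILS. Covers WINDOW-TABLE rows `HEX:k:l`,
`k ∈ {13, 14, 15, 16}`, every tabulated `l` (11, 13, 17, 19, 23 and the (P2)-primes `≤ 271`), both genuine local types.
[cite: Mochizuki2012, IUTchIII Cor. 3.12 Step (xi-f) p. 184; IUTchIV Prop. 1.2 p. 10] [claim: Mochizuki2012, status: disputed] -/
theorem not_pilotKummerCompatHull_lamSeven_of_dvd {k l : ℕ} (hk : 13 ≤ k) (hl : l.Prime) (h11 : 11 ≤ l) (h1680 : l ≤ 1680)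
    (T : Cor22.ThetaVolumeDatumAt (ratPoint ((2 : ℚ)⁻¹ + 2 / 7 ^ k)) l)
    (hloc : letI := T.instFieldF; letI := T.instNumberFieldF; letI := T.instAlgebraF; letI := T.instFieldK
      letI := T.instNumberFieldK; letI := T.instAlgebraK; letI := T.instFieldFbar; letI := T.instAlgebraFbar
      letI := T.instAlgebraKFbar; letI := T.instIsElliptic
      haveI : Fact (Nat.Prime 7) := ⟨by norm_num⟩
      ∀ x₀ : (thetaIndex (pilotDataOfK T.D T.K)).Fibre (.inr ⟨7, by norm_num⟩),
        ¬ 7 ∣ absRamificationIdx 7 (kOf (pilotDataOfK T.D T.K) 7 x₀) ∧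
          absRamificationIdx 7 (kOf (pilotDataOfK T.D T.K) 7 x₀) ∣ 60 * l) :
    letI := T.instFieldF; letI := T.instNumberFieldF; letI := T.instAlgebraF; letI := T.instFieldK
    letI := T.instNumberFieldK; letI := T.instAlgebraK; letI := T.instFieldFbar; letI := T.instAlgebraFbar
    letI := T.instAlgebraKFbar; letI := T.instIsElliptic
    ∀ (M : Type) [Field M] [NumberField M]
      (archPk : ∀ (j : (thetaIndex (pilotDataOfK T.D T.K)).Label) (vQ : (thetaIndex (pilotDataOfK T.D T.K)).VQ),
        Set ((logShellsDH (pilotDataOfK T.D T.K) (analyticLogv T.K)).Packet j vQ))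
      (archSub : ∀ (j : (thetaIndex (pilotDataOfK T.D T.K)).Label) (v : (thetaIndex (pilotDataOfK T.D T.K)).V),
        Set ((logShellsDH (pilotDataOfK T.D T.K) (analyticLogv T.K)).Packet j ((thetaIndex (pilotDataOfK T.D T.K)).over v)))
      (Ψ : ℤ → ∀ v : (thetaIndex (pilotDataOfK T.D T.K)).V, v ∈ (thetaIndex (pilotDataOfK T.D T.K)).Vbad →
        Set ((logShellsDH (pilotDataOfK T.D T.K) (analyticLogv T.K)).StarPacket v))
      (act : ℤ → ∀ v : (thetaIndex (pilotDataOfK T.D T.K)).V, v ∈ (thetaIndex (pilotDataOfK T.D T.K)).Vbad →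
        (logShellsDH (pilotDataOfK T.D T.K) (analyticLogv T.K)).StarPacket v →
          Module.End ℚ ((logShellsDH (pilotDataOfK T.D T.K) (analyticLogv T.K)).StarPacket v))
      (Mmod : ℤ → ∀ j : (thetaIndex (pilotDataOfK T.D T.K)).LabelStar,
        Set ((logShellsDH (pilotDataOfK T.D T.K) (analyticLogv T.K)).GlobalPacket j.1))
      (region : ℤ → ∀ j : (thetaIndex (pilotDataOfK T.D T.K)).LabelStar, FinDivisor M →
        ∀ vQ : (thetaIndex (pilotDataOfK T.D T.K)).VQ, Set ((logShellsDH (pilotDataOfK T.D T.K) (analyticLogv T.K)).Packet j.1 vQ))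
      (frobAdm : ℤ → ℤ → ∀ (j : (thetaIndex (pilotDataOfK T.D T.K)).Label) (vQ : (thetaIndex (pilotDataOfK T.D T.K)).VQ),
        Set ((logShellsDH (pilotDataOfK T.D T.K) (analyticLogv T.K)).Packet j vQ) → Prop)
      (frobLogvol : ℤ → ℤ → ∀ (j : (thetaIndex (pilotDataOfK T.D T.K)).Label) (vQ : (thetaIndex (pilotDataOfK T.D T.K)).VQ),
        Set ((logShellsDH (pilotDataOfK T.D T.K) (analyticLogv T.K)).Packet j vQ) → ℝ)
      (frobΨ : ℤ → ℤ → ∀ v : (thetaIndex (pilotDataOfK T.D T.K)).V, v ∈ (thetaIndex (pilotDataOfK T.D T.K)).Vbad →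
        Set ((logShellsDH (pilotDataOfK T.D T.K) (analyticLogv T.K)).StarPacket v))
      (frobMmod : ℤ → ℤ → ∀ j : (thetaIndex (pilotDataOfK T.D T.K)).LabelStar,
        Set ((logShellsDH (pilotDataOfK T.D T.K) (analyticLogv T.K)).GlobalPacket j.1))
      (unitImage : ℤ → ℤ → ℕ → ∀ (j : (thetaIndex (pilotDataOfK T.D T.K)).Label) (vQ : (thetaIndex (pilotDataOfK T.D T.K)).VQ),
        Set ((logShellsDH (pilotDataOfK T.D T.K) (analyticLogv T.K)).Packet j vQ))
      (ballImage : ℤ → ℤ → ∀ (j : (thetaIndex (pilotDataOfK T.D T.K)).Label) (vQ : (thetaIndex (pilotDataOfK T.D T.K)).VQ),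
        Set ((logShellsDH (pilotDataOfK T.D T.K) (analyticLogv T.K)).Packet j vQ))
      (thetaDiv : ℤ → ℤ → LgpDivisor M (thetaIndex (pilotDataOfK T.D T.K)).lstar)
      (n : ℤ) {HT : Type} {LogLink : HT → HT → Type} {IsFull : ∀ {s t : HT}, LogLink s t → Prop}
      (lat : LGPGaussianLogThetaLattice LogLink IsFull)
      {Frd : Type} {IsoF : Frd → Frd → Type} {Ob : Frd → Type} {realify : Frd → Frd} {Strip : Type}
      {IsoS : Strip → Strip → Type} {Mv : ∀ v : (thetaIndex (pilotDataOfK T.D T.K)).V, v ∈ (thetaIndex (pilotDataOfK T.D T.K)).Vbad → Type}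
      [∀ v h, Monoid (Mv v h)]
      (sig : GlobalLGPFrobenioidSignature (thetaIndex (pilotDataOfK T.D T.K)).lstar (thetaIndex (pilotDataOfK T.D T.K)).V
        (· ∈ (thetaIndex (pilotDataOfK T.D T.K)).Vbad) Frd IsoF Ob realify Strip IsoS Mv)
      (split : SplittingMonoids Mv) {ObΔ : Type}
      {N : ∀ v : (thetaIndex (pilotDataOfK T.D T.K)).V, v ∈ (thetaIndex (pilotDataOfK T.D T.K)).Vbad → Type}
      [∀ v h, Monoid (N v h)] (qData : QPilotData ObΔ N)
      (qK : ∀ v : (thetaIndex (pilotDataOfK T.D T.K)).V, v ∈ (thetaIndex (pilotDataOfK T.D T.K)).Vbad →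
        Set ((logShellsDH (pilotDataOfK T.D T.K) (analyticLogv T.K)).StarPacket v)),
    ¬ Cor312Vol.PilotKummerCompatHull
        (LatticeSituation.ofShells (logShellsDH (pilotDataOfK T.D T.K) (analyticLogv T.K)) M archPk archSub
          (summandPiecesPr (pilotDataOfK T.D T.K) (logvAnalytic_analyticLogv (F := T.K))).Adm
          (summandPiecesPr (pilotDataOfK T.D T.K) (logvAnalytic_analyticLogv (F := T.K))).logvol Ψ act Mmod region frobAdm
          frobLogvol frobΨ frobMmod unitImage ballImage thetaDiv)
        (settingPrVolSharp (pilotDataOfK T.D T.K) (logvAnalytic_analyticLogv (F := T.K)) M archPk archSub Ψ act Mmod region n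
          lat sig split qData (exists_realising_qIdeles_pilotDataOfK T.D).choose (exists_realising_thetaIdeles_pilotDataOfK T.D).choose
          (exists_realising_qIdeles_pilotDataOfK T.D).choose_spec.1 (exists_realising_qIdeles_pilotDataOfK T.D).choose_spec.2.1)
        (fun _ => Cor312.Setting.qRegion
          (settingPrVolSharp (pilotDataOfK T.D T.K) (logvAnalytic_analyticLogv (F := T.K)) M archPk archSub Ψ act Mmod region n
            lat sig split qData (exists_realising_qIdeles_pilotDataOfK T.D).choose (exists_realising_thetaIdeles_pilotDataOfK T.D).choose
            (exists_realising_qIdeles_pilotDataOfK T.D).choose_spec.1 (exists_realising_qIdeles_pilotDataOfK T.D).choose_spec.2.1))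
        qK := by
  obtain ⟨n, hn, hkl⟩ := exists_window_of_le_1680 hk h11 h1680
  exact GenuineK.not_pilotKummerCompatHull_lamSeven_of_ramification_le (E := 60 * l) (by omega) hl h11 hn hkl T
    (fun x₀ => Nat.le_of_dvd (by omega) (hloc x₀).2)

end HexLocalType

end Summit.ABC.IUTFork.Conditional

end
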